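import Literature.MathematicalPhysics.QuantumFieldTheory.Balaban1983to89.B9SupplySockB9P3ZdLetters
import Literature.MathematicalPhysics.QuantumFieldTheory.Balaban1983to89.B8Eq133Hypotheses

/-!
# `Balaban1983to89.B9SupplySockB9P3ZdFrame` — [Balaban1985BackgroundPropagators] Sect. A pp. 396–399 READ AT THE `ℤᵈ × 𝔸` CARRIER OF THE
# [Balaban1985RegularSpaces] LEAF: the CONCRETE [B9] FRAME (`B9.Geometry` ∕ `B9.Backgrounds` ∕ `B9.KernelFamily`) of the members
# `(M, i : B8LeafModelZd.ZdIdx d L, m)` over which `B9SupplySockB9P3ZdLetters.DictGlob` is PROVED (companion theorem file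
# `B9SupplySockB9P3ZdInstance`) — index `MemberZd`, blocks Δ(y) ∕ Δ̃(y) and 𝔅, the (2.46)-type block distance, the p. 396 cube class on `ℤᵈ`,
# the geometry `geoZd` (weighted norms (3.41) = `B8ScaledSupNorm.bondNorm`), the backgrounds `bgZd` WITH THE GENUINE CLASSES (3.35)–(3.38)
# (`B8Eq133Hypotheses.Reg335Zd` ∕ `B9Eq335RegularityClasses`), and the kernel family `GAZd` whose (3.47) global entries are the `ℤᵈ` norms of
# the operator letter `G(U₀)` (`B9SupplySockB9P3ZdLetters.OpsZd.Gop`)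

statement-level skeleton of published theorems with citation tags; proofs where landed; nothing here is a claim about the
Yang–Mills mass gap

PDF held: `paper:balaban1985-cmp99-background-propagators` ([4] = B9; journal page = PDF page + 388): p. 396 (the cube class, (3.35)–(3.38)),
p. 397 ((3.39)–(3.41), Δ(y), Δ̃(y), d(y, y′)), p. 398 ((3.42)–(3.47)), p. 399 (Thm 3.3; «the constants … depend on d, L only»); [B6] =
[Balaban1984PropagatorsII] p. 224 (2.1)–(2.4), p. 231 (2.45)–(2.46); [B8] = [Balaban1985RegularSpaces] p. 81 (1.28), p. 86 (1.58)–(1.59).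
Read by this seat on the held text layer (pp. 396–399, 2026-08-26) and through the verbatim quotations of `B9`, `B9Eq335RegularityClasses`,
`B8Eq133Hypotheses`, `B9BackgroundsKLevelV1` (referee-signed).

WHY THIS FILE (cell `pub-ymgap`, seat `pub-ymgap-dag-n06-e`, FAN-OUT v1.1 §N06 row s3 = n06-b's located residual (α); count-neutral).  The junction
J-N06→N05 is in the tree as a GENERIC theorem: `B9SupplySockB9P3Zd.sockB9P3_allLevels_of_thm33` supplies the [B8] in-edge b9 («∀ m ≤ k, SockB9P3 …»,
B8 p. 86 «Theorem 3.3 of [4] implies the bounds (1.59)») from `B9.Thm33Printed c35 geo bg Gp GA` over ANY [B9] frame `geo ∕ bg ∕ GA` indexed by a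
member map `mem : ℝ → ZdIdx d L → ℕ → I`, GIVEN the norm dictionary `DictGlob geo bg GA L mem ιCfg ιLoc ops` as a HYPOTHESIS.  n06-b's HANDOFF
(v0.7 §2c) located what remains on the definition side: «(α) a CONCRETE B9 frame at ℤᵈ with `DictGlob` by rfl … HAZARD: a frame whose `Reg335 := True`
(like `zdGF3`'s own field) cannot satisfy `CurvSmall`; the B9-side `bg` must carry the genuine (3.35) class».  This file IS that frame — the `ℤᵈ`
twin of the Stage-3′(Y) torus modules `B9BackgroundsKLevelV1.bg9K` ∕ `B9PinMembersKLevelV1` ∕ `B9PinCarriersKLevelV1.OperatorLayerY` (seat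
dag-n06-a «def-Y») over dag-n05-a's `ℤᵈ` index `B8LeafModelZd.ZdIdx` — so that the [B9] side of N05's b9 socket is ONE hypothesis BY NAME,
`B9.Thm33Printed c35 (geoZd 𝔸 L len) (bgZd 𝔸 L) Gp (GAZdFam 𝔸 L len ops loc)` (N06's node sentence (γ) for curved `U₀`, STATABLE at this
instance), and `DictGlob` is a theorem (`B9SupplySockB9P3ZdInstance.dictGlob_zd`).

WHAT IS DEFINED (definitions with bodies + `rfl`∕`Iff.rfl` unfoldings; NO theorem of the papers is asserted; no `instance`, no `notation`).
* §1 INDEX AND BLOCK GEOMETRY.  `MemberZd d L` = the junction's member `(M, i, m)` (block parameter `M` of [4] — REAL, as in the junction's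
  `mem` signature —, datum `i : ZdIdx d L`, truncation level `m`: B8 p. 88 «the same conditions for k − 1»), `memZd`; `blockZd L j y` = Δ(y) =
  Bʲ(y) («if y ∈ Λ_j, then Δ(y) = Bʲ(y)», p. 397) in η-lattice coordinates = the box `[Lʲy, Lʲ(y + 1) − 1]` of B8 (1.28) (`B8Ineq130.tlo ∕ thi`,
  the boxes of `ZdIdx.htower`); `blockTZd L j y` = Δ̃(y) («a cube of the size 2Lʲη on the lattice T_η with center at the point y») = that box
  widened by `⌊Lʲ∕2⌋` below and `⌈Lʲ∕2⌉` above; `blockZd_subset_blockTZd` (Δ ⊂ Δ̃); `BSite L x` = 𝔅 = ⋃_{j ≤ m} Λ_j ([B6] (2.45)) of the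
  member (pairs `(j, y)`, `y ∈ Λs m j`); `Touch`, `graphZd`, `distZd` = the (2.46)-type distance: the graph distance of the «two blocks touch»
  graph on 𝔅 (the reading of `B6Geom246MultiLevelBox` §2, `LatticeNorms.contourDist`; `SimpleGraph.dist`, value `0` between blocks joined by
  no chain); `boxZd`, `bigSideZd M L j := ⌈M⌉₊·Lʲ`, `IsCube396Zd`, `OmTrunc`, `cubeClass396Zd L x` = THE CUBE CLASS OF p. 396 on `ℤᵈ` («for each
  cube □ of this class there exists a unique index j, 0 ≤ j ≤ k, such that □ ⊂ Bʲ(Λ_j) ∪ B^{j+1}(Λ_{j+1}), □ ∩ Bʲ(Λ_j) ≠ ∅, and □ is a union of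
  several big blocks of the lattice T_{Lʲη}, which implies that its size in the lattice T_η is O(1)MLʲη. Here O(1) will mean a number ≤ 10») —
  the `ℤᵈ` twin of `B9BackgroundsKLevelV1.cubeClass396`; `levZd x z` = the level `j` of a site (`z ∈ Ω_j∖Ω_{j+1}`); `Sep22Zd R x` = [B6] (2.2)
  «(Lʲη)⁻¹dist(Ω_jᶜ, Ω_{j+1}) > RM» on `ℤᵈ` (NOT a field of `ZdIdx`; named here so that print's admissible sub-index is statable — HONEST
  SCOPE (b)); the norms `supNormZd` (3.39), `l2NormZd`, `cutSupZd`, `cutHZd`; **`geoZd 𝔸 L len x : B9.Geometry`** (every field with a body: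
  `Site := BSite`, `scale`, `dist := distZd`, `k := m`, `η`, `L`, `M`, `Loc :=` bond fields `Site d → Fin d → 𝔸` («λ replaced by a function J
  defined at bonds», Thm 3.3), `suppIn ∕ suppInT` = «supp J ⊂ Δ(y′) ∕ Δ̃(y′)» in the p. 77 bond convention (`B8Ineq132.BondTouches`), `supNorm`,
  `l2Norm`, **`wNorm γ := B8ScaledSupNorm.bondNorm L m η γ Ω`** = (3.41) in r05's reading, `holder ε := B9Eq340HolderZd.holder0 η ε len 1` (the
  FLAT (3.40) of the argument — the abstract `B9.Geometry.holder` has no `U` slot, the located reading of `B9GeoNormsKLevelV1` §HONEST SCOPE (2)),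
  `Cut := Site d → ℝ`, `cutIn ∕ cutInT` = «supp h ⊂ Δ(y)» ∕ «ζ ∈ C₀^∞(Δ̃(y))», `cutH β ζ := ‖ζ‖_β + |ζ|`, `cutSup h := |h|`).
* §2 BACKGROUNDS.  `CfgZd d 𝔸` = unitary-valued bond fields (= `B8LeafModelZd.zdGF .Cfg`); `Reg335BodyZd` := r05's transported class
  `B8Eq133Hypotheses.Reg335Zd η L (cubeClass396Zd L x) (c·M·α₀)` — (3.35) WITH BODY at the member's cube class («O(1)Mα₀» = `c·M·α₀`, `c` = the
  leaf's `c35`, as `bg9K`); `Reg336BodyZd`, `Cplx337BodyZd`, `Cplx338BodyZd` (r06's `B9Eq335RegularityClasses.Reg336 ∕ Cplx337 ∕ Cplx338`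
  transported by r05's `shiftT ∕ byDir`, «U′ = e^{iηA′}» = `B9Eq39Adjoint.fluct`, «on Ω_j» through `levZd`); **`bgZd 𝔸 L x : B9.Backgrounds`**;
  the embeddings `ιCfgZd` (a unitary `U₀` IS a configuration of the member) and `ιLocZd` (a bond field IS an argument) — identities; unfoldings
  `reg335_bgZd_iff` &c.
* §3 KERNEL FAMILY.  `LocalLettersZd 𝔸 L x` = the LOCAL functionals (3.42)–(3.46) of `G(U₀)` at the member and the `G∇*` global entry of (3.47)
  AS LETTERS (def-Y's `OperatorLayerY` pattern: a parameter record, nothing constructed — they are not read by the junction); `globZd` = the (3.47)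
  global entries n = 0, 1, 3 DEFINED from the operator letter `OpsZd.Gop` («|Gλ|_{(2+γ)}, |∇_UGλ|_{(1+γ)}, |Δ_UGλ|_{(γ)}»: `msup` at exponent
  `2 + γ` over the sides touching the `Ω_j`, `msup` at `1 + γ` of all components of `covDerivFwd`, `bondNorm` at `γ` of the componentwise
  `covLap` — EXACTLY dag-n05-a's three left-hand sides of B8 (1.59), as pinned by `DictGlob`); **`GAZd 𝔸 L len x ops loc : B9.KernelFamily (geoZd …)
  (bgZd …)`** and the family **`GAZdFam 𝔸 L len ops loc`** over n06-b's letter family `ops : ℝ → ZdIdx d L → ℕ → OpsZd d 𝔸`.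

HONEST SCOPE ∕ LOCATED READINGS.  (a) `M` is REAL (forced by the junction's `mem : ℝ → …` and `(geo _).M = M`); the lattice side of a big block is
`⌈M⌉₊·Lʲ` fine sites (print: `M` «a size of big blocks», an integer).  (b) THE INDEX RANGES OVER ALL `(M, i, m)`: `ZdIdx` carries B8's (1.28)∕(1.131)
geometry (`hbox ∕ hclass ∕ htower ∕ hpart`) but NOT [B6] (2.2)'s separation nor «Ω_j a union of big blocks» ([B6] (2.1)); print's Theorem 3.3 is
stated for sequences satisfying [B6] (2.1)–(2.4) with `M, R` sufficiently large (p. 399) — so `B9.Thm33Printed` AT THIS INSTANCE is print's theorem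
at the members with `Sep22Zd R x` (and (2.1)) and STRONGER than print at the others; the junction already quantifies over every `i : ZdIdx` (n05-a's
socket shape, unchanged here); a consumer wanting print-strength restricts the index to a subtype (the junction is generic in `I`).  (c) LETTERS,
NOT OBJECTS: `G(U₀)`, `Δ′(U₀)`, `R(U₀)`, `Q_j` are n06-b's `OpsZd` letters and the local functionals are `LocalLettersZd` letters; constructing them
([4] Sect. A (3.10)–(3.27), Thm 3.11) and PROVING `Thm33Printed` at this instance is N06's content ((β), (γ) of n06-b's census) — unchanged by this
file.  (d) Junk conventions (r05's): every `⨆` is a real `iSup` (`0` if unbounded ∕ empty), `distZd = 0` between unchained blocks, `levZd z = 0` off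
`Ω₀`, `OmTrunc j = ∅` above the truncation; `tsum`-junk `0` in `l2NormZd`.  (e) Δ(y′)-support of a BOND function in the p. 77 convention («at least
one end-point»; print does not spell the bond case); Δ̃ centred up to the half-integer of an even side.  (f) Count-neutral; N05∕N06 NOT discharged;
one finite lattice programme; nothing continuum ∕ ℝ⁴ ∕ OS ∕ mass-gap ∕ Clay.  Unit `pub-ymgap-dag-n06-e` (g0), 2026-08-26.
-/

noncomputable section

open NormedSpace

namespace Literature.MathematicalPhysics.QuantumFieldTheory.Balaban1983to89.B9SupplySockB9P3ZdFrame

open B7Prop1Local (InBox)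
open B7Prop2Explicit (unitaryUnits)
open B8Ineq130 (tlo thi)
open B8Ineq132 (covDerivFwd BondTouches)
open B8Eq140Level (SideTouches)
open B8ScaledSupNorm (bondNorm msup)
open B8Eq138LandauZd (covLap)
open B8LeafModelZd (ZdIdx)
open B8Eq133Hypotheses (shiftT byDir Reg335Zd)
open B9Eq340HolderZd (hquot AdmPair holder0)
open B9Eq39Adjoint (fluct)
open B9SupplySockB9P3ZdLetters (OpsZd)
open LatticeNorms (volElt linfDist)

-- `Site` alone could resolve to the torus sites of `Setup.lean`; re-export the `ℤ^d` sites of `B7Prop1Explicit`.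
export B7Prop1Explicit (Site)

variable {d : ℕ}

/-! ## §1 The index, the blocks Δ(y) ∕ Δ̃(y), 𝔅, the block distance, the p. 396 cube class, the norms, the geometry -/

/-- **A MEMBER OF THE [B9] FAMILY AT THE `ℤᵈ` CARRIER** = the junction's member `(M, i, m)`: the block parameter `M` of [4] (real — the junction's
`mem : ℝ → ZdIdx d L → ℕ → I`), dag-n05-a's datum `i : ZdIdx d L` (spacing `η`, levels `k`, `{Ω_j}`, constraint sets `Λs`, classes `Λb` with B8's
(1.28)∕(1.131) geometry), and the truncation level `m` (B8 p. 88 «the same conditions for k − 1»: the member has the `m + 1` levels `0, …, m`).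
Print's family index is «(torus, k, {Ω_j}, M) for fixed d, L» (p. 399). [cite: Balaban1985BackgroundPropagators, Thm 3.1 p.397 + p.399 (the family); Balaban1985RegularSpaces, Thm 4 p.88] -/
structure MemberZd (d L : ℕ) where
  /-- the block parameter `M` of [4] («M is a size of big blocks», [B6] (2.2)) -/
  M : ℝ
  /-- the `ℤᵈ` datum of the [B8] leaf -/
  i : ZdIdx d L
  /-- the truncation level (number of averaging levels of the member) -/
  m : ℕ

/-- the junction's member map `mem M i m := (M, i, m)`. [cite: Balaban1985BackgroundPropagators, p.399 (bookkeeping of the family index)] -/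
def memZd {L : ℕ} (M : ℝ) (i : ZdIdx d L) (m : ℕ) : MemberZd d L := ⟨M, i, m⟩

/-- `(memZd M i m).M = M`. [cite: Balaban1985BackgroundPropagators, p.399 (bookkeeping)] -/
theorem memZd_M {L : ℕ} (M : ℝ) (i : ZdIdx d L) (m : ℕ) : (memZd M i m).M = M := rfl
/-- `(memZd M i m).i = i`. [cite: Balaban1985BackgroundPropagators, p.399 (bookkeeping)] -/
theorem memZd_i {L : ℕ} (M : ℝ) (i : ZdIdx d L) (m : ℕ) : (memZd M i m).i = i := rfl
/-- `(memZd M i m).m = m`. [cite: Balaban1985BackgroundPropagators, p.399 (bookkeeping)] -/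
theorem memZd_m {L : ℕ} (M : ℝ) (i : ZdIdx d L) (m : ℕ) : (memZd M i m).m = m := rfl

/-- **Δ(y) = Bʲ(y)** («if y ∈ Λ_j, then Δ(y) = Bʲ(y)», p. 397) for a level-`j` coordinate `y`, in the coordinates of the `η`-lattice: the box
`[Lʲy, Lʲ(y + 1) − 1]` of B8 (1.28) (`B8Ineq130.tlo ∕ thi`, the boxes of `ZdIdx.htower`). [cite: Balaban1985BackgroundPropagators, p.397 (Δ(y) = Bʲ(y)); Balaban1985RegularSpaces, (1.28) p.81] -/
def blockZd (L j : ℕ) (y : Site d) : Set (Site d) :=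
  {z | InBox (tlo L y j) (thi L y j) z}

/-- **Δ̃(y)** («Δ̃(y) is a cube of the size 2Lʲη on the lattice T_η with center at the point y», p. 397): the box `Bʲ(y)` widened by `⌊Lʲ∕2⌋`
sites below and `⌈Lʲ∕2⌉` sites above in every direction (side `2Lʲ`, centred at the centre of `Bʲ(y)` up to the half-integer).
[cite: Balaban1985BackgroundPropagators, p.397 (Δ̃(y))] -/
def blockTZd (L j : ℕ) (y : Site d) : Set (Site d) :=
  {z | InBox (fun μ => tlo L y j μ - (L : ℤ) ^ j / 2) (fun μ => thi L y j μ + ((L : ℤ) ^ j - (L : ℤ) ^ j / 2)) z}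

/-- membership in `Δ(y)`, unfolded. [cite: Balaban1985BackgroundPropagators, p.397 (bookkeeping)] -/
theorem mem_blockZd_iff (L j : ℕ) (y z : Site d) : z ∈ blockZd L j y ↔ InBox (tlo L y j) (thi L y j) z := Iff.rfl

/-- **Δ(y) ⊂ Δ̃(y)** (the field `suppInT_of_suppIn ∕ cutInT_of_cutIn` every `B9.Geometry` must prove). [cite: Balaban1985BackgroundPropagators, p.397 (Δ, Δ̃)] -/
theorem blockZd_subset_blockTZd (L j : ℕ) (y : Site d) : blockZd L j y ⊆ blockTZd L j y := by
  intro z hz μ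
  have h0 : (0 : ℤ) ≤ (L : ℤ) ^ j := by positivity
  have h1 : (0 : ℤ) ≤ (L : ℤ) ^ j / 2 := Int.ediv_nonneg h0 (by norm_num)
  have h2 : (L : ℤ) ^ j / 2 ≤ (L : ℤ) ^ j := Int.ediv_le_self 2 h0
  obtain ⟨hlo, hhi⟩ := hz μ
  constructor <;> dsimp only <;> omega

/-- a larger set of sites touches every bond a smaller one touches (p. 77 bond convention). [cite: Balaban1985RegularSpaces, p.77 (convention before (1.5))] -/
theorem bondTouches_mono {S T : Set (Site d)} (h : S ⊆ T) {z : Site d} {μ : Fin d} (hb : BondTouches S z μ) : BondTouches T z μ :=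
  hb.imp (fun hz => h hz) (fun hz => h hz)

/-- **𝔅 = ⋃_{j ≤ m} Λ_j** of the member ([B6] (2.45) «𝔅 = ⋃_{j=0}^k Λ_j»; p. 397 «y, y′ ∈ 𝔅 = ⋃_{j=0}^k Λ_j»): the coarse sites of the
truncation-`m` tower, as pairs `(j, y)` with `y ∈ Λs m j` (level-`j` coordinates, B8 (1.28)). [cite: Balaban1985BackgroundPropagators, p.397 (𝔅); Balaban1984PropagatorsII, (2.45) p.231; Balaban1985RegularSpaces, (1.28) p.81] -/
def BSite (L : ℕ) (x : MemberZd d L) : Type :=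
  {p : ℕ × Site d // p.1 ≤ x.m ∧ p.2 ∈ x.i.Λs x.m p.1}

/-- two sets of fine sites TOUCH: they contain sites at sup-distance `≤ 1` (the admissible-bond reading of `B6Geom246MultiLevelBox` §2: «two distinct
blocks are joined by a bond iff they touch»). [cite: Balaban1984PropagatorsII, (2.46) p.231 (admissible bonds)] -/
def Touch (A B : Set (Site d)) : Prop :=
  ∃ z ∈ A, ∃ z' ∈ B, ∀ μ, |z μ - z' μ| ≤ 1

/-- `Touch` is symmetric. [cite: Balaban1984PropagatorsII, (2.46) p.231 (bookkeeping)] -/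
theorem Touch.symm {A B : Set (Site d)} (h : Touch A B) : Touch B A := by
  obtain ⟨z, hz, z', hz', hzz⟩ := h
  exact ⟨z', hz', z, hz, fun μ => by rw [abs_sub_comm]; exact hzz μ⟩

/-- **THE ADMISSIBLE-BOND GRAPH ON 𝔅** ([B6] (2.46): contours «built of admissible bonds»; the tree's reading `B6Geom246MultiLevelBox.bond`: two
DISTINCT blocks are adjacent iff their cubes `Δ(y)`, `Δ(y′)` touch). [cite: Balaban1984PropagatorsII, (2.46) p.231] -/
def graphZd (L : ℕ) (x : MemberZd d L) : SimpleGraph (BSite L x) where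
  Adj y y' := y ≠ y' ∧ Touch (blockZd L y.1.1 y.1.2) (blockZd L y'.1.1 y'.1.2)
  symm := ⟨fun _ _ h => ⟨fun e => h.1 e.symm, h.2.symm⟩⟩
  loopless := ⟨fun _ h => h.1 rfl⟩

/-- **d(y, y′)** («the weighted distance d(y, y′) defined by (2.46) in [4]», p. 397; [B6] (2.46) = the number of bonds of a shortest admissible
contour, `LatticeNorms.contourDist`'s reading): the graph distance of `graphZd`, as a real number (`SimpleGraph.dist`; `0` between blocks joined
by no admissible chain — junk guard (d) of the module docstring). [cite: Balaban1985BackgroundPropagators, p.397 (d(y, y′)); Balaban1984PropagatorsII, (2.46) p.231] -/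
def distZd (L : ℕ) (x : MemberZd d L) (y y' : BSite L x) : ℝ :=
  ((graphZd L x).dist y y' : ℝ)

/-- `d(y, y) = 0`. [cite: Balaban1984PropagatorsII, (2.46) p.231] -/
theorem distZd_self (L : ℕ) (x : MemberZd d L) (y : BSite L x) : distZd L x y y = 0 := by
  simp [distZd]

/-- `0 ≤ d(y, y′)`. [cite: Balaban1984PropagatorsII, (2.46) p.231] -/
theorem distZd_nonneg (L : ℕ) (x : MemberZd d L) (y y' : BSite L x) : 0 ≤ distZd L x y y' :=
  Nat.cast_nonneg _

/-- the cube of side `s` fine sites with lower corner `c`: `{z | c_μ ≤ z_μ < c_μ + s}`. [cite: Balaban1985BackgroundPropagators, p.396 («a class of cubes»)] -/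
def boxZd (c : Site d) (s : ℕ) : Set (Site d) :=
  {z | ∀ μ, c μ ≤ z μ ∧ z μ < c μ + s}

/-- the lower corner belongs to its cube (`s ≥ 1`). [cite: Balaban1985BackgroundPropagators, p.396 (bookkeeping)] -/
theorem mem_boxZd_self (c : Site d) {s : ℕ} (hs : 0 < s) : c ∈ boxZd c s :=
  fun μ => ⟨le_rfl, by omega⟩

/-- **the side of a big `j`-block in fine sites**: `⌈M⌉₊·Lʲ` («M is a size of big blocks», [B6] (2.2); «big blocks of the lattice T_{Lʲη}», p. 396;
`M` real here — HONEST SCOPE (a)). [cite: Balaban1985BackgroundPropagators, p.396; Balaban1984PropagatorsII, (2.2) p.224] -/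
def bigSideZd (M : ℝ) (L j : ℕ) : ℕ := ⌈M⌉₊ * L ^ j

/-- «□ is a union of several big blocks of the lattice T_{Lʲη}, which implies that its size in the lattice T_η is O(1)MLʲη. Here O(1) will mean a
number ≤ 10»: a cube of side `n·⌈M⌉₊·Lʲ` fine sites, `1 ≤ n ≤ 10`, with lower corner on the big-`j`-block grid (the `ℤᵈ` twin of
`B9BackgroundsKLevelV1.IsCube396`; no wrap-around clause on `ℤᵈ`). [cite: Balaban1985BackgroundPropagators, p.396 (the cube class)] -/
def IsCube396Zd (M : ℝ) (L j : ℕ) (cube : Set (Site d)) : Prop :=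
  ∃ (c : Site d) (n : ℕ), 1 ≤ n ∧ n ≤ 10 ∧ (∀ μ, (bigSideZd M L j : ℤ) ∣ c μ) ∧ cube = boxZd c (n * bigSideZd M L j)

/-- **Ω_j of the truncation-`m` member**: `Ω_j` for `j ≤ m`, `∅` above (the member's top territory is `Ω_m` itself: B8 p. 88 «the same conditions for
k − 1»). [cite: Balaban1985RegularSpaces, Thm 4 p.88, (1.3) p.77; Balaban1984PropagatorsII, (2.1) p.224] -/
def OmTrunc {L : ℕ} (x : MemberZd d L) (j : ℕ) : Set (Site d) :=
  if j ≤ x.m then x.i.Ω j else ∅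

/-- `OmTrunc x j = Ω_j` for `j ≤ m`. [cite: Balaban1985RegularSpaces, (1.3) p.77 (bookkeeping)] -/
theorem omTrunc_of_le {L : ℕ} (x : MemberZd d L) {j : ℕ} (hj : j ≤ x.m) : OmTrunc x j = x.i.Ω j := if_pos hj

/-- `OmTrunc x j = ∅` for `m < j`. [cite: Balaban1985RegularSpaces, Thm 4 p.88 (bookkeeping)] -/
theorem omTrunc_of_lt {L : ℕ} (x : MemberZd d L) {j : ℕ} (hj : x.m < j) : OmTrunc x j = ∅ := if_neg (not_le.mpr hj)

/-- the truncated sequence is nested: `OmTrunc (j + 1) ⊆ OmTrunc j` (from `ZdIdx.hΩ`). [cite: Balaban1985RegularSpaces, (1.3) p.77 («Ω₀ ⊃ Ω₁ ⊃ … ⊃ Ω_k»)] -/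
theorem omTrunc_succ_subset {L : ℕ} (x : MemberZd d L) (j : ℕ) : OmTrunc x (j + 1) ⊆ OmTrunc x j := by
  by_cases hj : j + 1 ≤ x.m
  · rw [omTrunc_of_le x hj, omTrunc_of_le x (Nat.le_of_succ_le hj)]
    exact x.i.hΩ j
  · rw [omTrunc_of_lt x (not_le.mp hj)]
    exact Set.empty_subset _

/-- **THE CUBE CLASS OF p. 396 AT THE `ℤᵈ` MEMBER**, as a family of (cube, index) pairs — the parameter `𝒬` of `B9Eq335RegularityClasses.Reg335` ∕
`B8Eq133Hypotheses.Reg335Zd`: index `j ≤ m`, `□` a class cube of index `j` (`IsCube396Zd`), «□ ⊂ Bʲ(Λ_j) ∪ B^{j+1}(Λ_{j+1})» (`□ ⊆ Ω_j`, `□ ∩ Ω_{j+2}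
= ∅`) and «□ ∩ Bʲ(Λ_j) ≠ ∅» (a site of `□` outside `Ω_{j+1}`), the `Ω`'s of the truncated member (`OmTrunc`).  The `ℤᵈ` twin of
`B9BackgroundsKLevelV1.cubeClass396`. [cite: Balaban1985BackgroundPropagators, p.396 (the cube class)] -/
def cubeClass396Zd (L : ℕ) (x : MemberZd d L) : Set (Set (Site d) × ℕ) :=
  {q | q.2 ≤ x.m ∧ IsCube396Zd x.M L q.2 q.1 ∧ q.1 ⊆ OmTrunc x q.2 ∧ Disjoint q.1 (OmTrunc x (q.2 + 2)) ∧
    ∃ z ∈ q.1, z ∉ OmTrunc x (q.2 + 1)}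

/-- membership in the cube class, unfolded. [cite: Balaban1985BackgroundPropagators, p.396 (bookkeeping)] -/
theorem mem_cubeClass396Zd_iff (L : ℕ) (x : MemberZd d L) (cube : Set (Site d)) (j : ℕ) :
    (cube, j) ∈ cubeClass396Zd L x ↔
      j ≤ x.m ∧ IsCube396Zd x.M L j cube ∧ cube ⊆ OmTrunc x j ∧ Disjoint cube (OmTrunc x (j + 2)) ∧
        ∃ z ∈ cube, z ∉ OmTrunc x (j + 1) :=
  Iff.rfl

/-- the index of a class cube is `≤ m`. [cite: Balaban1985BackgroundPropagators, p.396 («a unique index j, 0 ≤ j ≤ k»)] -/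
theorem cubeClass396Zd_index {L : ℕ} {x : MemberZd d L} {q : Set (Site d) × ℕ} (hq : q ∈ cubeClass396Zd L x) : q.2 ≤ x.m :=
  hq.1

/-- a class cube meets `Bʲ(Λ_j)` (so it is non-empty). [cite: Balaban1985BackgroundPropagators, p.396 («□ ∩ Bʲ(Λ_j) ≠ ∅»)] -/
theorem cubeClass396Zd_nonempty {L : ℕ} {x : MemberZd d L} {q : Set (Site d) × ℕ} (hq : q ∈ cubeClass396Zd L x) : q.1.Nonempty := by
  obtain ⟨z, hz, -⟩ := hq.2.2.2.2
  exact ⟨z, hz⟩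

/-- **THE LEVEL OF A SITE** of the truncation-`m` member: the largest `j ≤ m` with `z ∈ Ω_j` (so `z ∈ Ω_j∖Ω_{j+1}` reads `levZd x z = j`; «on Ω_j» for
`j ≤ m` reads `j ≤ levZd x z` for `z ∈ Ω₀` — `B9Eq335RegularityClasses.OnOmega`; `0` off `Ω₀`, junk guard (d)). [cite: Balaban1985BackgroundPropagators, (3.37) p.396 («on Ω_j, j = 0, …, k»), (3.41) p.397; Balaban1984PropagatorsII, (2.3)–(2.4) p.224] -/
def levZd {L : ℕ} (x : MemberZd d L) (z : Site d) : ℕ :=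
  sSup {j | j ≤ x.m ∧ z ∈ x.i.Ω j}

/-- **[B6] (2.2) AT THE `ℤᵈ` MEMBER** («(Lʲη)⁻¹dist(Ω_jᶜ, Ω_{j+1}) > RM, M is a size of big blocks and R is a big positive integer fixed later»): every
site outside `Ω_j` is at sup-distance (`LatticeNorms.linfDist`, fine sites) greater than `R·⌈M⌉₊·Lʲ` from every site of `Ω_{j+1}`, for `j + 1 ≤ m`.
NOT a field of `ZdIdx` (HONEST SCOPE (b)): named so that print's admissible sub-index `{x // Sep22Zd R x}` is statable.
[cite: Balaban1984PropagatorsII, (2.2) p.224; Balaban1985BackgroundPropagators, p.399 («M and R sufficiently large»)] -/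
def Sep22Zd {L : ℕ} (R : ℕ) (x : MemberZd d L) : Prop :=
  ∀ j, j + 1 ≤ x.m → ∀ z, z ∉ x.i.Ω j → ∀ z' ∈ x.i.Ω (j + 1), R * bigSideZd x.M L j < linfDist z z'

section Norms

variable {𝔸 : Type*} [SeminormedAddCommGroup 𝔸]

/-- **|J| of (3.39)** («|A| = max_μ sup_x |A_μ(x)|») for a bond field on `ℤᵈ`: a real `iSup` over all bonds (`0` if unbounded — r05's convention).
[cite: Balaban1985BackgroundPropagators, (3.39) p.397] -/
def supNormZd (J : Site d → Fin d → 𝔸) : ℝ :=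
  ⨆ b : Site d × Fin d, ‖J b.1 b.2‖

/-- **‖J‖, the L² norm of (3.46)** on the `η`-lattice: `(Σ_b η^d |J(b)|²)^{1∕2}` (`LatticeNorms.volElt`; `tsum`, junk `0` if not summable).
[cite: Balaban1985BackgroundPropagators, (3.46) p.398, p.390 (the η-lattice scalar product)] -/
def l2NormZd (η : ℝ) (J : Site d → Fin d → 𝔸) : ℝ :=
  Real.sqrt (∑' b : Site d × Fin d, volElt η d * ‖J b.1 b.2‖ ^ 2)

/-- **|h| for a cut-off function** `h` on sites («|h|» in (3.46), «|ζ|» in (3.43)): `sup_z |h(z)|` (real `iSup`). [cite: Balaban1985BackgroundPropagators, (3.43) + (3.46) p.398] -/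
def cutSupZd (h : Site d → ℝ) : ℝ :=
  ⨆ z : Site d, |h z|

/-- **‖ζ‖_β + |ζ| for a cut-off function** («B₀(β₀)(Lʲη)^{1−β}(‖ζ‖_β + |ζ|)» in (3.43)): the flat Hölder seminorm (3.40) of the real site function
`ζ` over the admissible pairs of `B9Eq340HolderZd.AdmPair η len` («x, x′ : |x − x′| ≤ 1», length function `len`) plus its sup.
[cite: Balaban1985BackgroundPropagators, (3.40) p.397, (3.43) p.398] -/
def cutHZd (η β : ℝ) (len : Site d → ℝ) (ζ : Site d → ℝ) : ℝ :=
  (⨆ p : AdmPair η len, |ζ p.1.2 - ζ p.1.1| / (η * len (p.1.2 - p.1.1)) ^ β) + cutSupZd ζ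

end Norms

section Geometry

variable (𝔸 : Type) [CStarAlgebra 𝔸] (L : ℕ) (len : Site d → ℝ)

/-- **THE [B9] SECT. A GEOMETRY OF THE `ℤᵈ` MEMBER `x = (M, i, m)`** (`B9.Geometry` with every field given a body): sites `𝔅` (`BSite`), `scale (j, y)
= j`, `dist = distZd` ((2.46)-type), `k = m`, `η = i.η`, `L`, `M`; arguments `Loc` = bond fields `J : Site d → Fin d → 𝔸` (Thm 3.3: «λ replaced by a
function J defined at bonds»), `suppIn J y′` = «supp J ⊂ Δ(y′)» and `suppInT J y′` = «supp J ⊂ Δ̃(y′)» (every bond where `J ≠ 0` touches the cube, p. 77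
convention), `supNorm` (3.39), `l2Norm` (3.46), **`wNorm γ J = |J|_{(γ)} := bondNorm L m η γ Ω J`** ((3.41) in r05's reading «b ∈ Ω_j» — p. 397: «For
α negative we can take Ω_j instead of Ω_j∖Ω_{j+1}»), `holder ε J` = the FLAT Hölder norm (3.40) of the argument (`holder0 η ε len 1`; located: no `U`
slot in `B9.Geometry.holder`), cut-offs `Cut = Site d → ℝ` with `cutIn h y` = «supp h ⊂ Δ(y)», `cutInT ζ y` = «ζ ∈ C₀^∞(Δ̃(y))» (on the lattice:
supported in Δ̃(y)), `cutH β ζ = ‖ζ‖_β + |ζ|`, `cutSup h = |h|`; Δ ⊂ Δ̃ by `blockZd_subset_blockTZd`.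
[cite: Balaban1985BackgroundPropagators, Sect. A (3.39)–(3.41) p.397, p.397 (Δ, Δ̃, d, 𝔅), Thm 3.3 p.399] -/
def geoZd (x : MemberZd d L) : B9.Geometry where
  Site := BSite L x
  scale y := y.1.1
  dist := distZd L x
  k := x.m
  eta := x.i.η
  L := L
  M := x.M
  Loc := Site d → Fin d → 𝔸
  suppIn J y := ∀ (z : Site d) (μ : Fin d), J z μ ≠ 0 → BondTouches (blockZd L y.1.1 y.1.2) z μ
  suppInT J y := ∀ (z : Site d) (μ : Fin d), J z μ ≠ 0 → BondTouches (blockTZd L y.1.1 y.1.2) z μ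
  supNorm := supNormZd
  l2Norm := l2NormZd x.i.η
  wNorm γ J := bondNorm L x.m x.i.η γ x.i.Ω J
  holder ε J := holder0 x.i.η ε len 1 J
  Cut := Site d → ℝ
  cutIn h y := ∀ z : Site d, h z ≠ 0 → z ∈ blockZd L y.1.1 y.1.2
  cutInT ζ y := ∀ z : Site d, ζ z ≠ 0 → z ∈ blockTZd L y.1.1 y.1.2
  cutH β ζ := cutHZd x.i.η β len ζ
  cutSup := cutSupZd
  suppInT_of_suppIn _ y h z μ hz := bondTouches_mono (blockZd_subset_blockTZd L y.1.1 y.1.2) (h z μ hz)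
  cutInT_of_cutIn _ y h z hz := blockZd_subset_blockTZd L y.1.1 y.1.2 (h z hz)

variable {𝔸 L len}

/-- `(geoZd … x).M = x.M` — so `(geoZd … (memZd M i m)).M = M`, the first clause of `DictGlob`. [cite: Balaban1985BackgroundPropagators, Thm 3.1 p.397 («for M ≥ M₁»; bookkeeping)] -/
theorem geoZd_M (x : MemberZd d L) : (geoZd 𝔸 L len x).M = x.M := rfl

/-- `(geoZd … x).eta = i.η`. [cite: Balaban1985BackgroundPropagators, (3.41) p.397 (bookkeeping)] -/
theorem geoZd_eta (x : MemberZd d L) : (geoZd 𝔸 L len x).eta = x.i.η := rfl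

/-- `(geoZd … x).k = m` (the member's number of levels). [cite: Balaban1985BackgroundPropagators, p.399 (bookkeeping)] -/
theorem geoZd_k (x : MemberZd d L) : (geoZd 𝔸 L len x).k = x.m := rfl

/-- **THE (3.41) FIELD IS r05's `bondNorm`**: `(geoZd … x).wNorm γ J = bondNorm L m η γ Ω J` — the second clause of `DictGlob` at `γ = −3`.
[cite: Balaban1985BackgroundPropagators, (3.41) p.397; Balaban1985RegularSpaces, p.86 (|·|₍α₎)] -/
theorem geoZd_wNorm (x : MemberZd d L) (γ : ℝ) (J : Site d → Fin d → 𝔸) :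
    (geoZd 𝔸 L len x).wNorm γ J = bondNorm L x.m x.i.η γ x.i.Ω J := rfl

/-- the scale length of a coarse site `(j, y)` is `Lʲη`. [cite: Balaban1985BackgroundPropagators, (3.41) p.397] -/
theorem geoZd_len (x : MemberZd d L) (y : BSite L x) : (geoZd 𝔸 L len x).len y = (L : ℝ) ^ y.1.1 * x.i.η := rfl

end Geometry

/-! ## §2 The backgrounds of the member: unitary configurations and the classes (3.35)–(3.38) with bodies -/

section Backgrounds

variable (d) (𝔸 : Type) [CStarAlgebra 𝔸]

/-- **the configurations of the `ℤᵈ` member**: unitary-valued bond fields `U : Site d → Fin d → 𝔸ˣ` (= `B8LeafModelZd.zdGF .Cfg`, the carrier of the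
[B8] leaf's backgrounds). [cite: Balaban1985BackgroundPropagators, Sect. A p.390 («U = {U(x, x′)} defined on bonds»); Balaban1985RegularSpaces, p.76 §A] -/
def CfgZd : Type :=
  {U : Site d → Fin d → 𝔸ˣ // ∀ x κ, U x κ ∈ unitaryUnits 𝔸}

variable {d} (L : ℕ)

/-- the body of the (3.35) field: r05's transported class `B8Eq133Hypotheses.Reg335Zd` («U₀ satisfies the regularity condition (3.35) in [4]») for the
member's `η`, `L`, the cube class `cubeClass396Zd L x` and the constant «O(1)Mα₀» = `c·M·α₀`.
[cite: Balaban1985BackgroundPropagators, (3.35) p.396; Balaban1985RegularSpaces, (1.33) p.82] -/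
def Reg335BodyZd (x : MemberZd d L) (c α₀ : ℝ) (U : CfgZd d 𝔸) : Prop :=
  Reg335Zd x.i.η L (cubeClass396Zd L x) (c * x.M * α₀) U.1

/-- the body of the (3.36) field: r06's `B9Eq335RegularityClasses.Reg336` transported by `shiftT ∕ byDir`, same data.
[cite: Balaban1985BackgroundPropagators, (3.35)–(3.36) p.396] -/
def Reg336BodyZd (x : MemberZd d L) (c α₀ : ℝ) (U : CfgZd d 𝔸) : Prop :=
  B9Eq335RegularityClasses.Reg336 (shiftT d) (byDir U.1) x.i.η (L : ℝ) (cubeClass396Zd L x) (c * x.M * α₀)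

/-- the body of the (3.37) field: «U′ = e^{iηA′}» (`B9Eq39Adjoint.fluct`) with `A′` in r06's class `Cplx337` on the `Ω_j` of the member (levels `levZd`).
[cite: Balaban1985BackgroundPropagators, (3.37) p.396] -/
def Cplx337BodyZd (x : MemberZd d L) (α₁ : ℝ) (U U' : CfgZd d 𝔸) : Prop :=
  ∃ A' : Fin d → Site d → 𝔸, byDir U'.1 = fluct x.i.η A' ∧
    B9Eq335RegularityClasses.Cplx337 (shiftT d) (byDir U.1) x.i.η (L : ℝ) (levZd x) α₁ A'

/-- the body of the (3.38) field. [cite: Balaban1985BackgroundPropagators, (3.38) p.396] -/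
def Cplx338BodyZd (x : MemberZd d L) (α₁ : ℝ) (U U' : CfgZd d 𝔸) : Prop :=
  ∃ A' : Fin d → Site d → 𝔸, byDir U'.1 = fluct x.i.η A' ∧
    B9Eq335RegularityClasses.Cplx338 (shiftT d) (byDir U.1) x.i.η (L : ℝ) (levZd x) α₁ A'

/-- **THE BACKGROUND CARRIER OF THE `ℤᵈ` MEMBER** — the `B9.Backgrounds` datum: unitary configurations, the trivial configuration, the product `U′U`
(«they have the form U′U», p. 396), and the four printed classes WITH BODIES (`Reg335BodyZd`, `Reg336BodyZd`, `Cplx337BodyZd`, `Cplx338BodyZd`) —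
n06-b's HAZARD honoured: `Reg335` is the genuine class, not `True`. [cite: Balaban1985BackgroundPropagators, (3.35)–(3.38) p.396] -/
def bgZd (x : MemberZd d L) : B9.Backgrounds where
  Cfg := CfgZd d 𝔸
  one := ⟨1, fun _ _ => (unitaryUnits 𝔸).one_mem⟩
  mul U' U := ⟨U'.1 * U.1, fun z κ => (unitaryUnits 𝔸).mul_mem (U'.2 z κ) (U.2 z κ)⟩
  Reg335 := Reg335BodyZd 𝔸 L x
  Reg336 := Reg336BodyZd 𝔸 L x
  Cplx337 := Cplx337BodyZd 𝔸 L x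
  Cplx338 := Cplx338BodyZd 𝔸 L x

/-- **a unitary background `U₀` IS a configuration of the member `(M, i, m)`** — the junction's embedding `ιCfg` (identity on the data).
[cite: Balaban1985BackgroundPropagators, Sect. A p.390 (bookkeeping)] -/
def ιCfgZd (M : ℝ) (i : ZdIdx d L) (m : ℕ) (U₀ : Site d → Fin d → 𝔸ˣ) (hU₀ : ∀ x κ, U₀ x κ ∈ unitaryUnits 𝔸) :
    (bgZd 𝔸 L (memZd M i m)).Cfg :=
  ⟨U₀, hU₀⟩

/-- **a bond field `J` IS an argument of the member's geometry** — the junction's embedding `ιLoc` (identity).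
[cite: Balaban1985BackgroundPropagators, Thm 3.3 p.399 («J defined at bonds»; bookkeeping)] -/
def ιLocZd (len : Site d → ℝ) (M : ℝ) (i : ZdIdx d L) (m : ℕ) (J : Site d → Fin d → 𝔸) : (geoZd 𝔸 L len (memZd M i m)).Loc :=
  J

variable {𝔸 L}

/-- the (3.35) field unfolded: r05's `Reg335Zd` at the member's cube class. [cite: Balaban1985BackgroundPropagators, (3.35) p.396 (bookkeeping)] -/
theorem reg335_bgZd_iff (x : MemberZd d L) (c α₀ : ℝ) (U : CfgZd d 𝔸) :
    (bgZd 𝔸 L x).Reg335 c α₀ U ↔ Reg335Zd x.i.η L (cubeClass396Zd L x) (c * x.M * α₀) U.1 :=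
  Iff.rfl

/-- the (3.36) field unfolded. [cite: Balaban1985BackgroundPropagators, (3.36) p.396 (bookkeeping)] -/
theorem reg336_bgZd_iff (x : MemberZd d L) (c α₀ : ℝ) (U : CfgZd d 𝔸) :
    (bgZd 𝔸 L x).Reg336 c α₀ U ↔
      B9Eq335RegularityClasses.Reg336 (shiftT d) (byDir U.1) x.i.η (L : ℝ) (cubeClass396Zd L x) (c * x.M * α₀) :=
  Iff.rfl

/-- the (3.37) field unfolded. [cite: Balaban1985BackgroundPropagators, (3.37) p.396 (bookkeeping)] -/
theorem cplx337_bgZd_iff (x : MemberZd d L) (α₁ : ℝ) (U U' : CfgZd d 𝔸) :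
    (bgZd 𝔸 L x).Cplx337 α₁ U U' ↔
      ∃ A' : Fin d → Site d → 𝔸, byDir U'.1 = fluct x.i.η A' ∧
        B9Eq335RegularityClasses.Cplx337 (shiftT d) (byDir U.1) x.i.η (L : ℝ) (levZd x) α₁ A' :=
  Iff.rfl

/-- (3.36) implies (3.35) at the member (r06's `Reg336.reg335` fieldwise). [cite: Balaban1985BackgroundPropagators, p.396 (after (3.36))] -/
theorem reg336_bgZd_reg335 (x : MemberZd d L) {c α₀ : ℝ} {U : CfgZd d 𝔸} (h : (bgZd 𝔸 L x).Reg336 c α₀ U) :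
    (bgZd 𝔸 L x).Reg335 c α₀ U :=
  B9Eq335RegularityClasses.Reg336.reg335 _ _ h

/-- the configuration underlying `ιCfgZd … U₀ hU₀` is `U₀`. [cite: Balaban1985BackgroundPropagators, Sect. A p.390 (bookkeeping)] -/
theorem ιCfgZd_val (M : ℝ) (i : ZdIdx d L) (m : ℕ) (U₀ : Site d → Fin d → 𝔸ˣ) (hU₀ : ∀ x κ, U₀ x κ ∈ unitaryUnits 𝔸) :
    (ιCfgZd 𝔸 L M i m U₀ hU₀).1 = U₀ :=
  rfl

/-- the argument underlying `ιLocZd … J` is `J`. [cite: Balaban1985BackgroundPropagators, Thm 3.3 p.399 (bookkeeping)] -/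
theorem ιLocZd_eq (len : Site d → ℝ) (M : ℝ) (i : ZdIdx d L) (m : ℕ) (J : Site d → Fin d → 𝔸) :
    ιLocZd 𝔸 L len M i m J = J :=
  rfl

/-- the (3.35) field AT THE JUNCTION'S MEMBER `(M, i, m)` and embedded background, in r05's letters (what `Prop6Feed ∕ InvOnSupp ∕ CurvSmall ∕ LandauKills`
read at this frame). [cite: Balaban1985BackgroundPropagators, (3.35) p.396; Balaban1985RegularSpaces, (1.33) p.82] -/
theorem reg335_bgZd_mem_iff (M : ℝ) (i : ZdIdx d L) (m : ℕ) (c α₀ : ℝ) (U₀ : Site d → Fin d → 𝔸ˣ)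
    (hU₀ : ∀ x κ, U₀ x κ ∈ unitaryUnits 𝔸) :
    (bgZd 𝔸 L (memZd M i m)).Reg335 c α₀ (ιCfgZd 𝔸 L M i m U₀ hU₀) ↔
      Reg335Zd i.η L (cubeClass396Zd L (memZd M i m)) (c * M * α₀) U₀ :=
  Iff.rfl

end Backgrounds

/-! ## §3 The kernel family of `G(U₀)` at the member: (3.47) global entries from the operator letter, local entries as letters -/

section Kernel

variable (𝔸 : Type) [CStarAlgebra 𝔸] (L : ℕ)

/-- **THE LOCAL FUNCTIONALS OF `G(U₀)` AT THE MEMBER, AS LETTERS** (def-Y's `OperatorLayerY` pattern — a parameter record, nothing constructed): the four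
sup entries (3.42) `e`, the Hölder entries (3.43) `h1` and (3.45) `h2`, the entry (3.44) `e4`, the six L² quantities (3.46) `l2` («with G′(U) replaced by
G(U) and λ replaced by a function J defined at bonds», Thm 3.3), and the `G∇*` global entry n = 2 of (3.47) (`glob2`; not read by B8 (1.59)).  Not read
by the junction; constructing them is N06's object layer. [cite: Balaban1985BackgroundPropagators, (3.42)–(3.47) pp.397–398, Thm 3.3 p.399] -/
structure LocalLettersZd (x : MemberZd d L) where
  /-- the (3.42) entries `|(GJ)(x)|, |(∇_UGJ)(x)|, |(G∇*_UJ)(x)|, |(Δ_UGJ)(x)|` localised at `y` -/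
  e : Fin 4 → CfgZd d 𝔸 → (Site d → Fin d → 𝔸) → BSite L x → ℝ
  /-- the (3.43) Hölder entries with cut-off `ζ` -/
  h1 : CfgZd d 𝔸 → (Site d → Fin d → 𝔸) → ℝ → (Site d → ℝ) → ℝ
  /-- the (3.44) entry `|(∇_UG∇*_UJ)(x)|` localised at `y` -/
  e4 : CfgZd d 𝔸 → (Site d → Fin d → 𝔸) → BSite L x → ℝ
  /-- the (3.45) Hölder entry with cut-off `ζ` -/
  h2 : CfgZd d 𝔸 → (Site d → Fin d → 𝔸) → ℝ → (Site d → ℝ) → ℝ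
  /-- the six L² quantities of (3.46) with cut-off `h` -/
  l2 : Fin 6 → CfgZd d 𝔸 → (Site d → Fin d → 𝔸) → (Site d → ℝ) → ℝ
  /-- the global entry n = 2 of (3.47), `|G∇*_UJ|_{(1+γ)}` -/
  glob2 : CfgZd d 𝔸 → (Site d → Fin d → 𝔸) → ℝ → ℝ

/-- **THE (3.47) GLOBAL ENTRIES OF `G(U₀)` AT THE MEMBER, DEFINED FROM THE OPERATOR LETTER** `ops.Gop` = `G(U₀)` («|Gλ|_{(2+γ)}, |∇_UGλ|_{(1+γ)},
|G∇*_Uλ|_{(1+γ)}, |Δ_UGλ|_{(γ)}»; 4th entry in the corrected reading of `B9.KernelFamily.glob`, G-B9-01): n = 0 ↦ r05's `msup` at exponent `2 + γ` of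
`G(U₀)J` over the sides touching the `Ω_j`; n = 1 ↦ `msup` at `1 + γ` of all components `(D^η_{U₀,κ}(G(U₀)J)_τ)(z)` (`B8Ineq132.covDerivFwd`); n = 2 ↦ the
letter `glob2`; n = 3 ↦ `bondNorm` at `γ` of the componentwise covariant Laplacian `B8Eq138LandauZd.covLap` — at `γ = −3` EXACTLY the three left-hand
sides of B8 (1.59) pinned by `B9SupplySockB9P3ZdLetters.DictGlob` (dag-n05-a's readings). [cite: Balaban1985BackgroundPropagators, (3.47) p.398, Thm 3.3 p.399; Balaban1985RegularSpaces, (1.59) p.86] -/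
def globZd (x : MemberZd d L) (ops : OpsZd d 𝔸) (glob2 : CfgZd d 𝔸 → (Site d → Fin d → 𝔸) → ℝ → ℝ)
    (n : Fin 4) (U : CfgZd d 𝔸) (J : Site d → Fin d → 𝔸) (γ : ℝ) : ℝ :=
  (![msup L x.m x.i.η (2 + γ) (fun j (b : Site d × Fin d) => SideTouches (x.i.Ω j) b.1 b.2) (fun b => ops.Gop U.1 J b.1 b.2),
      msup L x.m x.i.η (1 + γ) (fun j (t : Fin d × Fin d × Site d) => SideTouches (x.i.Ω j) t.2.2 t.2.1)
        (fun t => covDerivFwd x.i.η U.1 t.1 (fun z => ops.Gop U.1 J z t.2.1) t.2.2),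
      glob2 U J γ,
      bondNorm L x.m x.i.η γ x.i.Ω (fun z μ => covLap x.i.η U.1 (fun w => ops.Gop U.1 J w μ) z)] : Fin 4 → ℝ) n

variable (len : Site d → ℝ)

/-- **THE KERNEL FAMILY OF `G(U₀)` AT THE `ℤᵈ` MEMBER** (`B9.KernelFamily (geoZd …) (bgZd …)`): the (3.47) global entries `globZd` from the operator letter,
the local entries from the letter record `loc`. [cite: Balaban1985BackgroundPropagators, (3.42)–(3.47) pp.397–398, Thm 3.3 p.399] -/
def GAZd (x : MemberZd d L) (ops : OpsZd d 𝔸) (loc : LocalLettersZd 𝔸 L x) :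
    B9.KernelFamily (geoZd 𝔸 L len x) (bgZd 𝔸 L x) where
  e := loc.e
  h1 := loc.h1
  e4 := loc.e4
  h2 := loc.h2
  l2 := loc.l2
  glob := globZd 𝔸 L x ops loc.glob2

/-- **THE FAMILY OVER ALL MEMBERS** for n06-b's letter family `ops : ℝ → ZdIdx d L → ℕ → OpsZd d 𝔸` (the operators of the member `(M, i, m)`) and local
letters `loc` — the `GA` slot of `B9.Thm33Printed c35 (geoZd 𝔸 L len) (bgZd 𝔸 L) Gp (GAZdFam 𝔸 L len ops loc)`, N06's node sentence (γ) at this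
instance. [cite: Balaban1985BackgroundPropagators, Thm 3.3 p.399] -/
def GAZdFam (ops : ℝ → ZdIdx d L → ℕ → OpsZd d 𝔸) (loc : ∀ x : MemberZd d L, LocalLettersZd 𝔸 L x) (x : MemberZd d L) :
    B9.KernelFamily (geoZd 𝔸 L len x) (bgZd 𝔸 L x) :=
  GAZd 𝔸 L len x (ops x.M x.i x.m) (loc x)

variable {𝔸 L len}

/-- the global entry n = 0 unfolded: `|G(U₀)J|_{(2+γ)}` over the sides touching the `Ω_j`. [cite: Balaban1985BackgroundPropagators, (3.47) p.398] -/
theorem GAZd_glob_zero (x : MemberZd d L) (ops : OpsZd d 𝔸) (loc : LocalLettersZd 𝔸 L x) (U : CfgZd d 𝔸)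
    (J : Site d → Fin d → 𝔸) (γ : ℝ) :
    (GAZd 𝔸 L len x ops loc).glob 0 U J γ =
      msup L x.m x.i.η (2 + γ) (fun j (b : Site d × Fin d) => SideTouches (x.i.Ω j) b.1 b.2) (fun b => ops.Gop U.1 J b.1 b.2) :=
  rfl

/-- the global entry n = 1 unfolded: `|∇^η_{U₀}G(U₀)J|_{(1+γ)}`, all components of the forward covariant gradient. [cite: Balaban1985BackgroundPropagators, (3.47) p.398; Balaban1985RegularSpaces, (1.1) p.76] -/
theorem GAZd_glob_one (x : MemberZd d L) (ops : OpsZd d 𝔸) (loc : LocalLettersZd 𝔸 L x) (U : CfgZd d 𝔸)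
    (J : Site d → Fin d → 𝔸) (γ : ℝ) :
    (GAZd 𝔸 L len x ops loc).glob 1 U J γ =
      msup L x.m x.i.η (1 + γ) (fun j (t : Fin d × Fin d × Site d) => SideTouches (x.i.Ω j) t.2.2 t.2.1)
        (fun t => covDerivFwd x.i.η U.1 t.1 (fun z => ops.Gop U.1 J z t.2.1) t.2.2) :=
  rfl

/-- the global entry n = 2 is the letter `glob2`. [cite: Balaban1985BackgroundPropagators, (3.47) p.398] -/
theorem GAZd_glob_two (x : MemberZd d L) (ops : OpsZd d 𝔸) (loc : LocalLettersZd 𝔸 L x) (U : CfgZd d 𝔸)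
    (J : Site d → Fin d → 𝔸) (γ : ℝ) :
    (GAZd 𝔸 L len x ops loc).glob 2 U J γ = loc.glob2 U J γ :=
  rfl

/-- the global entry n = 3 unfolded: `|Δ^η_{U₀}G(U₀)J|_{(γ)}`, componentwise covariant Laplacian. [cite: Balaban1985BackgroundPropagators, (3.47) p.398; Balaban1985RegularSpaces, (1.39) p.83] -/
theorem GAZd_glob_three (x : MemberZd d L) (ops : OpsZd d 𝔸) (loc : LocalLettersZd 𝔸 L x) (U : CfgZd d 𝔸)
    (J : Site d → Fin d → 𝔸) (γ : ℝ) :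
    (GAZd 𝔸 L len x ops loc).glob 3 U J γ =
      bondNorm L x.m x.i.η γ x.i.Ω (fun z μ => covLap x.i.η U.1 (fun w => ops.Gop U.1 J w μ) z) :=
  rfl

end Kernel

end Literature.MathematicalPhysics.QuantumFieldTheory.Balaban1983to89.B9SupplySockB9P3ZdFrame

end
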